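import Summits.CriticalPhenomena.CardyFormulaZ2.Theses.CardyBoundaryCoulombGas
import Summits.CriticalPhenomena.CardyFormulaZ2.Theorems.CardyBoundaryCoulombGasStripClusterRatesBetheKernelToolkit

/-!
# Stub `stub_betheGroundExists` (BX) of line `two-cluster-rate-is-stationary-gap`
# (crux `CardyBoundaryCoulombGas.StripClusterRates`, stmt-CriticalPhenomena-13878)

**BX · existence of ground-state Bethe roots.** For `2M ≤ N` the ground-state Bethe equations
(quantum numbers `J_j = j`) of the open staggered six-vertex / Temperley–Lieb(`β = 1`) chain at
`γ = π/3` (Yung–Batchelor 1995),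
`N·F(w_j) - Σ_{l ≠ j} [G(w_j - w_l) + G(w_j + w_l)] = π (j+1)`,
`F(w) = arctan((2+√3) tanh w) + arctan(tanh w)`, `G(x) = arctan(tanh x / √3)`,
have an ordered positive real solution `0 < w_0 < ⋯ < w_{M-1}`.

Proof (elementary, Brouwer-free; abstract form `bx_exists_solution`). Facts used: `F` continuous,
strictly increasing, `F 0 = 0`, `F(B) = θ := (πM + (M-1)π/3)/N < 2π/3 = sup F` for some `B ≥ 0`;
`G` continuous, monotone, odd, `G ≤ π/6` — all from the landed Bethe kernel toolkit
(`…StripClusterRatesBetheKernelToolkit`, `bk_*`). With primitives `IF' = F`, `IG' = G` the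
Yang–Yang function `S(w) = Σ_j [N·IF(w_j) - π(j+1) w_j] - ½ Σ_{j ≠ l} [IG(w_j - w_l) + IG(w_j + w_l)]`
has a minimiser `w⋆` on the compact convex `C = {0 ≤ w ≤ B, w monotone}`;
`v_j = F⁻¹((π(j+1) + Σ_j(w⋆))/N)` lies in `C` (order facts on the brackets `G(a-b) + G(a+b)`), the
derivative of `t ↦ S(w⋆ + t(v - w⋆))` at `0⁺` is `N Σ_j (v_j - w⋆_j)(F(w⋆_j) - F(v_j))`, nonnegative
by minimality and termwise nonpositive (`F` increasing) — hence `v = w⋆`, the Bethe system.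
-/

noncomputable section

namespace Summit.CriticalPhenomena.CardyFormulaZ2.Cruxes.StripClusterRates.TwoClusterRateIsStationaryGap

open Filter Topology
open scoped BigOperators

section Abstract

variable {F G : ℝ → ℝ} {c : ℝ}

/-- For `a ≥ 0` the bracket `G(a - b) + G(a + b)` is nonnegative (`G` odd monotone). [folklore] -/
theorem bx_bracket_nonneg (hGm : Monotone G) (hGodd : ∀ x, G (-x) = -G x) {a b : ℝ}
    (ha : 0 ≤ a) : 0 ≤ G (a - b) + G (a + b) := by
  have h1 : G (-(a - b)) ≤ G (a + b) := hGm (by linarith)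
  rw [hGodd] at h1
  linarith

/-- The bracket is monotone in its first argument. [folklore] -/
theorem bx_bracket_mono (hGm : Monotone G) {a a' : ℝ} (h : a ≤ a') (b : ℝ) :
    G (a - b) + G (a + b) ≤ G (a' - b) + G (a' + b) :=
  add_le_add (hGm (by linarith)) (hGm (by linarith))

/-- Cross brackets compare: `G(a - a') + G(a + a') ≤ G(a' - a) + G(a' + a)` for `a ≤ a'`.
[folklore] -/
theorem bx_bracket_cross (hGm : Monotone G) (hGodd : ∀ x, G (-x) = -G x) {a a' : ℝ}
    (h : a ≤ a') : G (a - a') + G (a + a') ≤ G (a' - a) + G (a' + a) := by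
  have hG0 : G 0 = 0 := by linarith [(neg_zero (G := ℝ)) ▸ hGodd 0]
  have h0 : G 0 ≤ G (a' - a) := hGm (by linarith)
  have h1 : G (a - a') = -G (a' - a) := by rw [← hGodd, neg_sub]
  rw [h1, add_comm a a']
  linarith

/-- The scattering sums `Σ_j(w) = ∑_{l ≠ j} [G(w_j - w_l) + G(w_j + w_l)]` increase with `j`
along a monotone configuration. [folklore] -/
theorem bx_sigma_mono (hGm : Monotone G) (hGodd : ∀ x, G (-x) = -G x) {M : ℕ} (w : Fin M → ℝ)
    {i j : Fin M} (hij : i ≠ j) (hw : w i ≤ w j) :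
    ∑ l ∈ Finset.univ.erase i, (G (w i - w l) + G (w i + w l)) ≤
      ∑ l ∈ Finset.univ.erase j, (G (w j - w l) + G (w j + w l)) := by
  have hi : i ∈ Finset.univ.erase j := Finset.mem_erase.2 ⟨hij, Finset.mem_univ i⟩
  have hj : j ∈ Finset.univ.erase i := Finset.mem_erase.2 ⟨hij.symm, Finset.mem_univ j⟩
  rw [← Finset.add_sum_erase _ _ hi, ← Finset.add_sum_erase _ _ hj, Finset.erase_right_comm]
  exact add_le_add (bx_bracket_cross hGm hGodd hw)
    (Finset.sum_le_sum fun l _ => bx_bracket_mono hGm hw _)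

/-- **The order-preserving map `v = Φ(w)`.** For a monotone nonnegative configuration `w`, the
equations `N·F(v_j) = π(j+1) + Σ_j(w)` have a strictly increasing positive solution `v ≤ B` as
soon as `F(B) ≥ (πM + (M-1)·2c)/N`. [folklore] -/
theorem bx_exists_v (hF : Continuous F) (hFm : StrictMono F) (hF0 : F 0 = 0)
    (hGm : Monotone G) (hGodd : ∀ x, G (-x) = -G x) (hGc : ∀ x, G x ≤ c)
    {N : ℝ} (hN : 0 < N) {M : ℕ} {B : ℝ} (hB : 0 ≤ B)
    (hθ : (Real.pi * M + ((M : ℝ) - 1) * (2 * c)) / N ≤ F B)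
    (w : Fin M → ℝ) (hw0 : ∀ j, 0 ≤ w j) (hwm : Monotone w) :
    ∃ v : Fin M → ℝ, StrictMono v ∧ (∀ j, 0 < v j) ∧ (∀ j, v j ≤ B) ∧
      ∀ j, N * F (v j) =
        Real.pi * ((j : ℕ) + 1) + ∑ l ∈ Finset.univ.erase j, (G (w j - w l) + G (w j + w l)) := by
  have hSnn : ∀ j, 0 ≤ ∑ l ∈ Finset.univ.erase j, (G (w j - w l) + G (w j + w l)) := fun j =>
    Finset.sum_nonneg fun l _ => bx_bracket_nonneg hGm hGodd (hw0 j)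
  have hSle : ∀ j : Fin M,
      ∑ l ∈ Finset.univ.erase j, (G (w j - w l) + G (w j + w l)) ≤ ((M : ℝ) - 1) * (2 * c) := by
    intro j
    have h := Finset.sum_le_card_nsmul (Finset.univ.erase j)
      (fun l => G (w j - w l) + G (w j + w l)) (2 * c)
      fun l _ => by linarith [hGc (w j - w l), hGc (w j + w l)]
    rwa [Finset.card_erase_of_mem (Finset.mem_univ j), Finset.card_univ, Fintype.card_fin,
      nsmul_eq_mul, Nat.cast_sub (Nat.succ_le_of_lt (Fin.pos j)), Nat.cast_one] at h
  have hT : ∀ j : Fin M,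
      (Real.pi * ((j : ℕ) + 1) + ∑ l ∈ Finset.univ.erase j, (G (w j - w l) + G (w j + w l))) / N ∈
        Set.Icc (F 0) (F B) := by
    intro j
    rw [hF0]
    refine ⟨div_nonneg (add_nonneg (by positivity) (hSnn j)) hN.le, le_trans ?_ hθ⟩
    have hjM : ((j : ℕ) : ℝ) + 1 ≤ (M : ℝ) := by
      have : (j : ℕ) + 1 ≤ M := j.isLt
      exact_mod_cast this
    exact div_le_div_of_nonneg_right
      (add_le_add (mul_le_mul_of_nonneg_left hjM Real.pi_pos.le) (hSle j)) hN.le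
  have hex : ∀ j : Fin M, ∃ x ∈ Set.Icc 0 B, F x =
      (Real.pi * ((j : ℕ) + 1) + ∑ l ∈ Finset.univ.erase j, (G (w j - w l) + G (w j + w l))) / N :=
    fun j => intermediate_value_Icc hB hF.continuousOn (hT j)
  choose v hvB hvF using hex
  refine ⟨v, ?_, ?_, fun j => (hvB j).2, fun j => ?_⟩
  · intro i j hij
    rw [← hFm.lt_iff_lt, hvF, hvF]
    refine div_lt_div_of_pos_right ?_ hN
    have h1 : Real.pi * ((i : ℕ) + 1) < Real.pi * ((j : ℕ) + 1) := by
      have : ((i : ℕ) : ℝ) < ((j : ℕ) : ℝ) := by exact_mod_cast hij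
      nlinarith [Real.pi_pos]
    exact add_lt_add_of_lt_of_le h1 (bx_sigma_mono hGm hGodd w (ne_of_lt hij) (hwm hij.le))
  · intro j
    rw [← hFm.lt_iff_lt, hF0, hvF]
    exact div_pos (add_pos_of_pos_of_nonneg (by positivity) (hSnn j)) hN
  · rw [hvF]
    field_simp

/-- Off-diagonal double sums commute. [folklore] -/
theorem bx_sum_erase_comm {M : ℕ} (f : Fin M → Fin M → ℝ) :
    ∑ j, ∑ l ∈ Finset.univ.erase j, f j l = ∑ j, ∑ l ∈ Finset.univ.erase j, f l j := by
  have h : ∀ g : Fin M → Fin M → ℝ,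
      ∑ j, ∑ l ∈ Finset.univ.erase j, g j l = ∑ j, ∑ l, g j l - ∑ j, g j j := by
    intro g
    rw [← Finset.sum_sub_distrib]
    exact Finset.sum_congr rfl fun j _ => Finset.sum_erase_eq_sub (Finset.mem_univ j)
  rw [h, h, Finset.sum_comm]

/-- Symmetrisation of the derivative of the interaction term (uses oddness of `G`). [folklore] -/
theorem bx_symmetrise (hGodd : ∀ x, G (-x) = -G x) {M : ℕ} (w d : Fin M → ℝ) :
    (1 / 2 : ℝ) * ∑ j, ∑ l ∈ Finset.univ.erase j,
        (G (w j - w l) * (d j - d l) + G (w j + w l) * (d j + d l)) =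
      ∑ j, d j * ∑ l ∈ Finset.univ.erase j, (G (w j - w l) + G (w j + w l)) := by
  have hsplit : ∀ j l, G (w j - w l) * (d j - d l) + G (w j + w l) * (d j + d l) =
      d j * (G (w j - w l) + G (w j + w l)) + d l * (G (w l - w j) + G (w l + w j)) := by
    intro j l
    have : G (w l - w j) = -G (w j - w l) := by rw [← hGodd, neg_sub]
    rw [this, add_comm (w l) (w j)]
    ring
  have h2 : ∑ j, ∑ l ∈ Finset.univ.erase j,
      (G (w j - w l) * (d j - d l) + G (w j + w l) * (d j + d l)) =
      ∑ j, ∑ l ∈ Finset.univ.erase j, d j * (G (w j - w l) + G (w j + w l)) +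
        ∑ j, ∑ l ∈ Finset.univ.erase j, d l * (G (w l - w j) + G (w l + w j)) := by
    rw [← Finset.sum_add_distrib]
    refine Finset.sum_congr rfl fun j _ => ?_
    rw [← Finset.sum_add_distrib]
    exact Finset.sum_congr rfl fun l _ => hsplit j l
  have h3 : ∑ j, ∑ l ∈ Finset.univ.erase j, d j * (G (w j - w l) + G (w j + w l)) =
      ∑ j, d j * ∑ l ∈ Finset.univ.erase j, (G (w j - w l) + G (w j + w l)) :=
    Finset.sum_congr rfl fun j _ => (Finset.mul_sum _ _ _).symm
  rw [h2, bx_sum_erase_comm (fun j l => d l * (G (w l - w j) + G (w l + w j))), h3]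
  ring

/-- Derivative at `t = 0` of the Yang–Yang function `S` along `t ↦ w + t·d`. [folklore] -/
theorem bx_hasDerivAt_phi {IF IG : ℝ → ℝ} (hIF : ∀ x, HasDerivAt IF (F x) x)
    (hIG : ∀ x, HasDerivAt IG (G x) x) {M : ℕ} (N : ℝ) (w d : Fin M → ℝ)
    {S : (Fin M → ℝ) → ℝ}
    (hS : ∀ u, S u = ∑ j, (N * IF (u j) - Real.pi * ((j : ℕ) + 1) * u j) -
      (1 / 2) * ∑ j, ∑ l ∈ Finset.univ.erase j, (IG (u j - u l) + IG (u j + u l))) :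
    HasDerivAt (fun t : ℝ => S (w + t • d))
      (∑ j, (N * (F (w j) * d j) - Real.pi * ((j : ℕ) + 1) * d j) -
        (1 / 2) * ∑ j, ∑ l ∈ Finset.univ.erase j,
          (G (w j - w l) * (d j - d l) + G (w j + w l) * (d j + d l))) 0 := by
  have hfun : (fun t : ℝ => S (w + t • d)) = fun t =>
      ∑ j, (N * IF (w j + t * d j) - Real.pi * ((j : ℕ) + 1) * (w j + t * d j)) -
        (1 / 2) * ∑ j, ∑ l ∈ Finset.univ.erase j,
          (IG (w j + t * d j - (w l + t * d l)) + IG (w j + t * d j + (w l + t * d l))) := by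
    funext t
    rw [hS]
    simp only [Pi.add_apply, Pi.smul_apply, smul_eq_mul]
  rw [hfun]
  have hlin : ∀ j : Fin M, HasDerivAt (fun t : ℝ => w j + t * d j) (d j) 0 := fun j =>
    (hasDerivAt_mul_const (d j)).const_add (w j)
  refine (HasDerivAt.fun_sum fun j _ => ?_).fun_sub
    ((HasDerivAt.fun_sum fun j _ => HasDerivAt.fun_sum fun l _ => ?_).const_mul _)
  · have h1 := (hIF (w j + 0 * d j)).comp 0 (hlin j)
    simp only [zero_mul, add_zero, Function.comp_def] at h1
    exact (h1.const_mul N).fun_sub ((hlin j).const_mul _)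
  · have h1 := (hIG _).comp 0 ((hlin j).fun_sub (hlin l))
    have h2 := (hIG _).comp 0 ((hlin j).fun_add (hlin l))
    simp only [zero_mul, add_zero, Function.comp_def] at h1 h2
    exact h1.fun_add h2

/-- One-sided first-order condition: a function on `[0,1]` minimal at `0` and differentiable there
has nonnegative derivative. [folklore] -/
theorem bx_deriv_nonneg_of_min {φ : ℝ → ℝ} {D : ℝ} (hφ : HasDerivAt φ D 0)
    (hmin : ∀ t ∈ Set.Ioc (0 : ℝ) 1, φ 0 ≤ φ t) : 0 ≤ D := by
  refine ge_of_tendsto hφ.tendsto_slope_zero_right ?_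
  filter_upwards [Ioc_mem_nhdsGT (zero_lt_one' ℝ)] with t ht
  rw [zero_add, smul_eq_mul]
  exact mul_nonneg (inv_nonneg.2 ht.1.le) (sub_nonneg.2 (hmin t ht))

/-- **Abstract existence of ordered positive Bethe roots** (Yang–Yang variational argument). For
`F` continuous strictly increasing with `F 0 = 0`, `G` continuous monotone odd with `G ≤ c`, `N > 0`
and a cutoff `B ≥ 0` with `F(B) ≥ (πM + (M-1)·2c)/N`, the system
`N·F(w_j) - Σ_{l ≠ j}[G(w_j - w_l) + G(w_j + w_l)] = π(j+1)` has a strictly increasing positive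
solution: a minimiser of the Yang–Yang function on the compact convex set of ordered configurations
in `[0, B]^M` coincides with its order-preserving image `Φ(w)`. [folklore] -/
theorem bx_exists_solution (hF : Continuous F) (hG : Continuous G) (hFm : StrictMono F)
    (hGm : Monotone G) (hF0 : F 0 = 0) (hGodd : ∀ x, G (-x) = -G x) (hGc : ∀ x, G x ≤ c)
    {N : ℝ} (hN : 0 < N) (M : ℕ) {B : ℝ} (hB : 0 ≤ B)
    (hθ : (Real.pi * M + ((M : ℝ) - 1) * (2 * c)) / N ≤ F B) :
    ∃ w : Fin M → ℝ, StrictMono w ∧ (∀ j, 0 < w j) ∧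
      ∀ j : Fin M, N * F (w j) - ∑ l ∈ Finset.univ.erase j, (G (w j - w l) + G (w j + w l)) =
        Real.pi * ((j : ℕ) + 1) := by
  -- primitives of `F` and `G`, and the Yang–Yang function (kept opaque via defining equations)
  obtain ⟨IF, hIF⟩ : ∃ I : ℝ → ℝ, ∀ x, HasDerivAt I (F x) x :=
    ⟨fun u => ∫ x in (0 : ℝ)..u, F x, fun x => (hF.integral_hasStrictDerivAt 0 x).hasDerivAt⟩
  obtain ⟨IG, hIG⟩ : ∃ I : ℝ → ℝ, ∀ x, HasDerivAt I (G x) x :=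
    ⟨fun u => ∫ x in (0 : ℝ)..u, G x, fun x => (hG.integral_hasStrictDerivAt 0 x).hasDerivAt⟩
  have hIFc : Continuous IF := continuous_iff_continuousAt.2 fun x => (hIF x).continuousAt
  have hIGc : Continuous IG := continuous_iff_continuousAt.2 fun x => (hIG x).continuousAt
  obtain ⟨S, hS⟩ : ∃ S : (Fin M → ℝ) → ℝ, ∀ u, S u =
      ∑ j, (N * IF (u j) - Real.pi * ((j : ℕ) + 1) * u j) -
        (1 / 2) * ∑ j, ∑ l ∈ Finset.univ.erase j, (IG (u j - u l) + IG (u j + u l)) :=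
    ⟨fun u => ∑ j, (N * IF (u j) - Real.pi * ((j : ℕ) + 1) * u j) -
        (1 / 2) * ∑ j, ∑ l ∈ Finset.univ.erase j, (IG (u j - u l) + IG (u j + u l)), fun u => rfl⟩
  have hSc : Continuous S := by
    rw [show S = _ from funext hS]
    fun_prop
  -- the compact set of ordered configurations in `[0, B]` and a minimiser `w` of `S` on it
  set C : Set (Fin M → ℝ) := {u | (∀ j, 0 ≤ u j) ∧ (∀ j, u j ≤ B) ∧ Monotone u} with hC
  have hCcpt : IsCompact C := by
    have h1 : C = Set.Icc (0 : Fin M → ℝ) (fun _ => B) ∩ {u | Monotone u} := by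
      ext u
      simp only [hC, Set.mem_inter_iff, Set.mem_Icc, Set.mem_setOf_eq, Pi.le_def, Pi.zero_apply]
      tauto
    have h2 : {u : Fin M → ℝ | Monotone u} =
        ⋂ (a : Fin M) (b : Fin M) (_ : a ≤ b), {u | u a ≤ u b} := by ext u; simp [Monotone]
    rw [h1, h2]
    exact isCompact_Icc.inter_right (isClosed_iInter fun a => isClosed_iInter fun b =>
      isClosed_iInter fun _ => isClosed_le (continuous_apply a) (continuous_apply b))
  have hCne : C.Nonempty := ⟨fun _ => 0, fun _ => le_rfl, fun _ => hB, fun _ _ _ => le_rfl⟩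
  obtain ⟨w, ⟨hw0, hwB, hwm⟩, hmin⟩ := hCcpt.exists_isMinOn hCne hSc.continuousOn
  -- its order-preserving image `v = Φ(w)`; the segment from `w` to `v` stays in `C`
  obtain ⟨v, hvm, hv0, hvB, hvF⟩ := bx_exists_v hF hFm hF0 hGm hGodd hGc hN hB hθ w hw0 hwm
  set d : Fin M → ℝ := v - w with hd
  have hseg : ∀ t ∈ Set.Icc (0 : ℝ) 1, w + t • d ∈ C := by
    intro t ht
    have hcoord : ∀ j, (w + t • d) j = (1 - t) * w j + t * v j := fun j => by
      simp only [hd, Pi.add_apply, Pi.smul_apply, Pi.sub_apply, smul_eq_mul]; ring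
    refine ⟨fun j => ?_, fun j => ?_, fun a b hab => ?_⟩
    · rw [hcoord]
      exact add_nonneg (mul_nonneg (by linarith [ht.2]) (hw0 j)) (mul_nonneg ht.1 (hv0 j).le)
    · rw [hcoord]
      nlinarith [hwB j, hvB j, ht.1, ht.2, hw0 j]
    · rw [hcoord, hcoord]
      exact add_le_add (mul_le_mul_of_nonneg_left (hwm hab) (by linarith [ht.2]))
        (mul_le_mul_of_nonneg_left (hvm.monotone hab) ht.1)
  -- first-order condition at `t = 0` along the segment, symmetrised
  have hφmin : ∀ t ∈ Set.Ioc (0 : ℝ) 1, S (w + (0 : ℝ) • d) ≤ S (w + t • d) := by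
    intro t ht
    have h := isMinOn_iff.mp hmin _ (hseg t ⟨ht.1.le, ht.2⟩)
    rwa [zero_smul, add_zero]
  have hD := bx_deriv_nonneg_of_min (bx_hasDerivAt_phi hIF hIG N w d hS) hφmin
  rw [bx_symmetrise hGodd w d] at hD
  have hDeq : ∑ j, (N * (F (w j) * d j) - Real.pi * ((j : ℕ) + 1) * d j) -
      ∑ j, d j * ∑ l ∈ Finset.univ.erase j, (G (w j - w l) + G (w j + w l)) =
      N * ∑ j, d j * (F (w j) - F (v j)) := by
    rw [← Finset.sum_sub_distrib, Finset.mul_sum]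
    exact Finset.sum_congr rfl fun j _ => by linear_combination (d j) * hvF j
  rw [hDeq] at hD
  -- every summand is nonpositive (`F` increasing), hence zero, hence `v = w`
  have hterm : ∀ j, d j * (F (w j) - F (v j)) ≤ 0 := by
    intro j
    simp only [hd, Pi.sub_apply]
    rcases le_total (w j) (v j) with h | h
    · nlinarith [hFm.monotone h, mul_nonneg (sub_nonneg.2 h) (sub_nonneg.2 (hFm.monotone h))]
    · nlinarith [hFm.monotone h, mul_nonneg (sub_nonneg.2 h) (sub_nonneg.2 (hFm.monotone h))]
  have hsum0 : ∑ j, d j * (F (w j) - F (v j)) = 0 := by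
    have h1 : ∑ j, d j * (F (w j) - F (v j)) ≤ 0 := Finset.sum_nonpos fun j _ => hterm j
    have h2 : 0 ≤ ∑ j, d j * (F (w j) - F (v j)) := by
      by_contra hneg
      linarith [mul_neg_of_pos_of_neg hN (not_le.mp hneg)]
    linarith
  have hvw : v = w := by
    funext j
    have hj := (Finset.sum_eq_zero_iff_of_nonpos fun j _ => hterm j).1 hsum0 j (Finset.mem_univ j)
    rcases mul_eq_zero.1 hj with h | h
    · simpa [hd, sub_eq_zero] using h
    · exact (hFm.injective (sub_eq_zero.1 h)).symm
  refine ⟨w, hvw ▸ hvm, hvw ▸ hv0, fun j => ?_⟩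
  have := hvF j
  rw [hvw] at this
  linarith

end Abstract

/-- **BX — existence of ground-state Bethe roots.** For `2M ≤ N` the ground-state Bethe equations
of the open staggered six-vertex / Temperley–Lieb(`β = 1`) chain at `γ = π/3` (quantum numbers
`J_j = j`; Yung–Batchelor 1995), `N·F(w_j) - Σ_{l ≠ j}[G(w_j - w_l) + G(w_j + w_l)] = π(j+1)` with
`F(w) = arctan((2+√3) tanh w) + arctan(tanh w)`, `G(x) = arctan(tanh x/√3)`, admit an ordered
positive real solution; the proof is the variational argument `bx_exists_solution` with a
cutoff `B ≥ 0`, `F(B) = π(4M-1)/(3N) < 2π/3` (toolkit `bk_F_surjOn`). [folklore] -/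
theorem stub_betheGroundExists :
    ∀ N M : ℕ, 2 * M ≤ N → ∃ w : Fin M → ℝ,
      StrictMono w ∧ (∀ j, 0 < w j) ∧
        ∀ j : Fin M, (N : ℝ) * (Real.arctan ((2 + Real.sqrt 3) * Real.tanh (w j)) + Real.arctan (Real.tanh (w j))) -
          ∑ l ∈ Finset.univ.erase j,
            (Real.arctan (Real.tanh (w j - w l) / Real.sqrt 3) + Real.arctan (Real.tanh (w j + w l) / Real.sqrt 3)) =
          Real.pi * ((j : ℕ) + 1) := by
  intro N M hMN
  rcases Nat.eq_zero_or_pos M with hM | hM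
  · subst hM
    exact ⟨Fin.elim0, fun ⦃a⦄ => Fin.elim0 a, fun a => Fin.elim0 a, fun a => Fin.elim0 a⟩
  have hN : (0 : ℝ) < N := Nat.cast_pos.mpr (by omega)
  have hMN' : 2 * (M : ℝ) ≤ N := by exact_mod_cast hMN
  have hM1 : (1 : ℝ) ≤ M := by exact_mod_cast hM
  -- the level `θ = π(4M-1)/(3N) ∈ [0, 2π/3)` is a value `F(B)`, `B ≥ 0` (toolkit `bk_F_surjOn`)
  have hθ0 : 0 ≤ (Real.pi * M + ((M : ℝ) - 1) * (2 * (Real.pi / 6))) / N :=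
    div_nonneg (add_nonneg (by positivity) (mul_nonneg (by linarith) (by positivity))) hN.le
  have hθlt : (Real.pi * M + ((M : ℝ) - 1) * (2 * (Real.pi / 6))) / N < 2 * Real.pi / 3 := by
    rw [div_lt_iff₀ hN]
    nlinarith [mul_le_mul_of_nonneg_left hMN' Real.pi_pos.le, Real.pi_pos]
  obtain ⟨B, hB, hFB⟩ := bk_F_surjOn hθ0 hθlt
  exact bx_exists_solution bk_F_continuous bk_G_continuous bk_F_strictMono bk_G_strictMono.monotone
    bk_F_zero bk_G_neg (fun x => (bk_G_lt x).le) hN M hB hFB.ge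

end Summit.CriticalPhenomena.CardyFormulaZ2.Cruxes.StripClusterRates.TwoClusterRateIsStationaryGap

end
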